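import Summits.CriticalPhenomena.PercolationContinuityZ3.Theorems.FK.Transplant.KNFreeSlabRouting
import HarnessLib

/-!
# FRONTIER TRANSPLANT, binder 2 (TP_FK) — T4-SLAB (L2): lane infrastructure II — PER-DIRECTION plate steps, single explicit
# edges, LANE REGIONS `(U ∩ Z) ∖ (S ∖ {z, w})` under a pinned ambient law, the slab-box corollary

Support file (`--supports stmt-CriticalPhenomena-4575`, helper) of the FRONTIER TRANSPLANT sub-cell (`fk-continuity/transplant/`,
seat `prim-bschramm-fkt-p1`); builds on p205010 (kernel theorem, internal audit signed; external expert review pending).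
0 definitions · 0 named facts · 0 sorries · standard axioms. File 4/18 of the bytes-first package (R60 (3)(β)) of the
UNFUNDED memo row `T4-SLAB [g122, R60]` (re-described R62 (E)); proposable only on a coordinator ruling.
Registered R63 (cell INBOX l.4709, 2026-08-23); registry row T4s; lead label T4s-04 (fkt-lead L22, l.4677).

HONEST FRAMING (page 1, cell rule). The transplant's theorem of record `ufsc0_of_freeBoundaryHypothesis_r3` (p248245) is
CONDITIONAL on FH AND on TP_FK = `KNFreeTargetHittable d q p`, both OPEN at the same `p` for `q > 1` near `p_c(q)` (⇔ GRC Conj.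
(5.103) via K1; barrier note `Literature.Barriers.CriticalPhenomena.SamePFreeBoundaryCriteria`, FBN-01, cited first); the
transplant is a typed reduction, not a proof of FK continuity. THIS FILE: PER-DIRECTION plate steps (`pow_le_fkLaw_Icc_real_openConnIn_of_steps`: two points of a box with
per-direction step widths `k_b N_b` are joined inside it with free-law probability `≥ β^{Σ k_b}` — lanes confined to a
slab never step across it), single explicit edges under the free law of a region, LANE REGIONS `R = (U ∩ Z) ∖ (S ∖ {z,
w})` (the ambient pinned law dominates `lattW p` on their pairs when the frozen set meets `R` only in `{z, w}` and `z,
w` are not neighbours: `lattW_le_pinW_of_frozen_pair`), the slab-box corollary `…_slabBox`, lattice adjacency of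
coordinate neighbours. It proves nothing about either binder and says nothing at `p ↓ p_c(q)`; NOT `_r4`; `_r3` « 2 / 0 ☑ », n_open = 2,
BINDER-OWNERS, FO-19 NO-GO unchanged.

Declarations: `pow_le_fkLaw_Icc_real_openConnIn_of_steps`, `setOf_mem_subset_openConnIn`,
`ratio_le_fkLaw_restrW_real_edge`, `fkLaw_restrW_real_openConnIn_mono_region`, `mem_pair_of_mem_sdiff_sdiff`,
`lattW_le_pinW_of_frozen_pair`, `zdGraph_adj_of_eq_off`, `pow_le_fkLaw_Icc_real_openConnIn_slabBox`,
`ratio_le_fkLaw_restrW_real_openConnIn_edge`, `le_fkLaw_restrW_real_openConnIn_of_subbox` (a third direction in `d ≥ 3` is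
Mathlib's `Fin.exists_ne_and_ne_of_two_lt`; R63 (γ)).

References: G. Grimmett, *The Random-Cluster Model*, Springer 2006, Thm. (3.1) eq. (3.4), Thm. (3.7), Thm. (3.8), Thm. (3.21)
eq. (3.22), Lemma (4.13), §5.7 [Grimmett2006]; G. Kozma, S. Nitzan, arXiv:2401.12397 (2024), §4 Lemma 10 Step IV (pp. 19–21) [KozmaNitzan2024].
-/

noncomputable section

namespace Summit.CriticalPhenomena.PercolationContinuityZ3.Theorems.FK

open MeasureTheory
open scoped ENNReal Classical
open Literature.Probability.Percolation Literature.Probability.LatticeModels SimpleGraph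
open Literature.Probability.Percolation.GadgetSystem Literature.Probability.Percolation.KozmaNitzan Transplant
open Literature.Barriers.CriticalPhenomena

variable {d : ℕ}

/-! ### (P1) v5 — PER-DIRECTION plate steps: lanes confined to a slab never step across it

The fat-box workhorse above moves every coordinate with ONE step half-width `N`; a lane of the slab Step IV lives
in a slab `{|z_c - ζ_k| ≤ L}` of width `2L+1` (so that the `n` lanes are pairwise disjoint) and therefore never
moves in the slab direction `c`, while in the other directions the admissible step half-width is per direction
(`N_b ≤` half the width of the box in `b` AND in a pairing direction `pr b ≠ b`). -/

/-- **Any two points of a box, with per-direction step half-widths.** `Icc lo hi` has every width `≥ 2L`; for each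
direction `b` in which `s` and `t` differ we are given a pairing direction `pr b ≠ b`, a step half-width `N_b` with
`width_b, width_{pr b} ≥ 2N_b`, and a step count `kb_b` with `|s_b - t_b| ≤ kb_b·N_b` (directions with `s_b = t_b`
cost nothing but may carry any `kb_b`). Then `φ^free_box(s ↔ t in the box) ≥ β^{Σ_b kb_b}`, `0 ≤ β ≤ 1` the
placed-copy two-point bound, uniform in the long half-width (`Π(p,L)` ⇒ `β = α²`).
[cite: Grimmett2006, §5.7 eq. (5.102), Thm. (3.8), eq. (3.22); KozmaNitzan2024, §4 Lemma 10 Step IV (pp. 19–21)] -/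
theorem pow_le_fkLaw_Icc_real_openConnIn_of_steps {q : ℝ} (hq : 1 ≤ q) (p : unitInterval) (hd : 2 ≤ d) {L : ℕ}
    {β : ℝ} (hβ0 : 0 ≤ β) (hβ1 : β ≤ 1)
    (hβ : ∀ (N : ℕ) (g : zdGraph d ≃g zdGraph d) (u z : Site d), u ∈ fkSlab d L N → z ∈ fkSlab d L N →
      β ≤ (fkLaw ((fkSlab d L N).image g) (restrW (↑((fkSlab d L N).image g) : Set (Site d)) (lattW d p)) q).real
        (openConnIn (↑((fkSlab d L N).image g) : Set (Site d)) (g u) (g z)))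
    (lo hi : Site d) (hwide : ∀ i, lo i + 2 * (L : ℤ) ≤ hi i)
    (Nst : Fin d → ℕ) (pr : Fin d → Fin d) (kb : Fin d → ℕ)
    {s t : Site d} (hs : s ∈ Finset.Icc lo hi) (ht : t ∈ Finset.Icc lo hi)
    (hmove : ∀ b, s b ≠ t b →
      pr b ≠ b ∧ lo b + 2 * (Nst b : ℤ) ≤ hi b ∧ lo (pr b) + 2 * (Nst b : ℤ) ≤ hi (pr b) ∧
        |s b - t b| ≤ (kb b : ℤ) * Nst b) :
    β ^ (∑ b, kb b) ≤ (fkLaw (Finset.Icc lo hi) (restrW (↑(Finset.Icc lo hi) : Set (Site d)) (lattW d p)) q).real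
      (openConnIn (↑(Finset.Icc lo hi) : Set (Site d)) s t) := by
  have hq0 : 0 < q := one_pos.trans_le hq
  haveI : IsProbabilityMeasure
      (fkLaw (Finset.Icc lo hi) (restrW (↑(Finset.Icc lo hi) : Set (Site d)) (lattW d p)) q) :=
    isProbabilityMeasure_fkLaw _ _ hq0
  have hsI : (∀ i, lo i ≤ s i) ∧ ∀ i, s i ≤ hi i := by
    have := hs; rw [Finset.mem_Icc, Pi.le_def, Pi.le_def] at this; exact this
  have htI : (∀ i, lo i ≤ t i) ∧ ∀ i, t i ≤ hi i := by
    have := ht; rw [Finset.mem_Icc, Pi.le_def, Pi.le_def] at this; exact this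
  -- hybrid points: `z n` takes `t`'s value on the coordinates `< n` and `s`'s value on the others
  set z : ℕ → Site d := fun n i => if (i : ℕ) < n then t i else s i with hz
  have hz0 : z 0 = s := by funext i; simp [hz]
  have hzd : z d = t := by funext i; simp [hz, i.2]
  have hzI : ∀ n, z n ∈ Finset.Icc lo hi := by
    intro n
    rw [Finset.mem_Icc, Pi.le_def, Pi.le_def]
    constructor <;> intro i <;> simp only [hz] <;> split_ifs
    · exact htI.1 i
    · exact hsI.1 i
    · exact htI.2 i
    · exact hsI.2 i
  have key : ∀ n : ℕ, n ≤ d → β ^ (∑ i ∈ Finset.univ.filter (fun i : Fin d => (i : ℕ) < n), kb i) ≤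
      (fkLaw (Finset.Icc lo hi) (restrW (↑(Finset.Icc lo hi) : Set (Site d)) (lattW d p)) q).real
        (openConnIn (↑(Finset.Icc lo hi) : Set (Site d)) s (z n)) := by
    intro n
    induction n with
    | zero =>
      intro _
      have hempty : Finset.univ.filter (fun i : Fin d => (i : ℕ) < 0) = ∅ := by ext i; simp
      rw [hempty, Finset.sum_empty, pow_zero, hz0]
      have hsB : s ∈ (↑(Finset.Icc lo hi) : Set (Site d)) := Finset.mem_coe.2 hs
      have huniv : (openConnIn (↑(Finset.Icc lo hi) : Set (Site d)) s s : Set (BondConfig (Site d))) = Set.univ := by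
        ext ω; simp only [Set.mem_univ, iff_true]; exact ⟨hsB, hsB, SimpleGraph.Reachable.refl _⟩
      rw [huniv, probReal_univ]
    | succ n ih =>
      intro hn
      have ih' := ih (Nat.le_of_succ_le hn)
      set b : Fin d := ⟨n, by omega⟩ with hb
      have hsplit : Finset.univ.filter (fun i : Fin d => (i : ℕ) < n + 1) =
          insert b (Finset.univ.filter (fun i : Fin d => (i : ℕ) < n)) := by
        ext i
        simp only [Finset.mem_filter, Finset.mem_univ, true_and, Finset.mem_insert, hb]
        constructor
        · intro h
          by_cases h' : (i : ℕ) < n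
          · exact Or.inr h'
          · left; ext; simp; omega
        · rintro (h | h)
          · rw [h]; simp
          · omega
      have hnotin : b ∉ Finset.univ.filter (fun i : Fin d => (i : ℕ) < n) := by simp [hb]
      rw [hsplit, Finset.sum_insert hnotin, pow_add]
      -- the leg `z n → z (n+1)` changes only coordinate `b`
      have hzoff : ∀ i, i ≠ b → z n i = z (n + 1) i := by
        intro i hi
        simp only [hz]
        have : (i : ℕ) ≠ n := fun h => hi (by ext; simp [hb, h])
        by_cases h1 : (i : ℕ) < n
        · simp [h1, show (i : ℕ) < n + 1 by omega]
        · simp [h1, show ¬ (i : ℕ) < n + 1 by omega]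
      have hzb : z n b = s b ∧ z (n + 1) b = t b := by
        constructor
        · show (if ((b : Fin d) : ℕ) < n then t b else s b) = s b
          simp [hb]
        · show (if ((b : Fin d) : ℕ) < n + 1 then t b else s b) = t b
          simp [hb]
      have hleg : β ^ kb b ≤ (fkLaw (Finset.Icc lo hi) (restrW (↑(Finset.Icc lo hi) : Set (Site d)) (lattW d p)) q).real
          (openConnIn (↑(Finset.Icc lo hi) : Set (Site d)) (z n) (z (n + 1))) := by
        by_cases hst : s b = t b
        · -- no move: the two hybrid points coincide
          have heq : z n = z (n + 1) := by
            funext i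
            by_cases hi : i = b
            · subst hi; rw [hzb.1, hzb.2, hst]
            · exact hzoff i hi
          rw [← heq]
          have hzB : z n ∈ (↑(Finset.Icc lo hi) : Set (Site d)) := Finset.mem_coe.2 (hzI n)
          have huniv : (openConnIn (↑(Finset.Icc lo hi) : Set (Site d)) (z n) (z n) : Set (BondConfig (Site d))) =
              Set.univ := by
            ext ω; simp only [Set.mem_univ, iff_true]; exact ⟨hzB, hzB, SimpleGraph.Reachable.refl _⟩
          rw [huniv, probReal_univ]
          exact pow_le_one₀ hβ0 hβ1
        · obtain ⟨hpb, hwb, hwpb, hkb⟩ := hmove b hst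
          refine pow_le_fkLaw_Icc_real_openConnIn_line hq p hd hβ0 (hβ (Nst b)) lo hi hpb.symm hwide hwb hwpb
            (kb b) (hzI n) (hzI (n + 1)) hzoff ?_
          rw [hzb.1, hzb.2]; exact hkb
      calc β ^ kb b * β ^ (∑ i ∈ Finset.univ.filter (fun i : Fin d => (i : ℕ) < n), kb i)
          = β ^ (∑ i ∈ Finset.univ.filter (fun i : Fin d => (i : ℕ) < n), kb i) * β ^ kb b := mul_comm _ _
        _ ≤ _ := mul_le_fkLaw_real_openConnIn_trans (Finset.Icc lo hi) _ hq _ s (z n) (z (n + 1))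
            (pow_nonneg hβ0 _) ih' hleg
  have hall : Finset.univ.filter (fun i : Fin d => (i : ℕ) < d) = Finset.univ := by ext i; simp
  have := key d le_rfl
  rw [hall, hzd] at this
  exact this

/-! ### (P2) v5 — LANE COMPOSITION along waypoints inside ONE region (FKG), and the two step kinds -/

/-- **Edge step.** An open lattice edge between two vertices of `R` joins them inside `R`. [folklore] -/
theorem setOf_mem_subset_openConnIn {R : Set (Site d)} {u v : Site d} (hu : u ∈ R) (hv : v ∈ R) (huv : u ≠ v) :
    {ω : BondConfig (Site d) | s(u, v) ∈ ω} ⊆ openConnIn R u v := by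
  intro ω hω
  refine ⟨hu, hv, SimpleGraph.Adj.reachable ?_⟩
  simp only [SimpleGraph.comap_adj, Function.Embedding.coe_subtype, SimpleGraph.induce, openGraph_adj]
  exact ⟨hω, huv⟩

/-- **Edge step, probability** (insertion tolerance): under the free law of a region `R ∋ u, v` with `u ~ v`,
the edge `uv` is open with probability `≥ p̃ = p/(p+q(1-p))`. [cite: Grimmett2006, Thm. (3.1) eq. (3.4)] -/
theorem ratio_le_fkLaw_restrW_real_edge {q : ℝ} (hq : 1 ≤ q) (p : unitInterval) (R : Finset (Site d))
    {u v : Site d} (hu : u ∈ R) (hv : v ∈ R) (hadj : (zdGraph d).Adj u v) :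
    (p : ℝ) / (p + q * (1 - p)) ≤
      (fkLaw R (restrW (↑R : Set (Site d)) (lattW d p)) q).real {ω | s(u, v) ∈ ω} := by
  have hq0 : 0 < q := one_pos.trans_le hq
  haveI : IsProbabilityMeasure (fkLaw R (restrW (↑R : Set (Site d)) (lattW d p)) q) :=
    isProbabilityMeasure_fkLaw _ _ hq0
  have hF : ∀ e ∈ ({s(u, v)} : Finset (Sym2 (Site d))), restrW (↑R : Set (Site d)) (lattW d p) e = p := by
    intro e he
    rw [Finset.mem_singleton] at he; subst he
    have hw : s(u, v) ∈ wireSet (↑R : Set (Site d)) :=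
      mk_mem_wireSet_iff.2 ⟨Finset.mem_coe.2 hu, Finset.mem_coe.2 hv, hadj.ne⟩
    rw [restrW_apply_of_mem _ hw, lattW_mk, if_pos hadj]
  have hFR : ∀ e ∈ ({s(u, v)} : Finset (Sym2 (Site d))), ∀ x ∈ e, x ∈ R := by
    intro e he x hx
    rw [Finset.mem_singleton] at he; subst he
    rcases Sym2.mem_iff.1 hx with rfl | rfl
    · exact hu
    · exact hv
  have h := pow_mul_real_le_fkLaw_real_subset_inter hq R _ hF hFR isUpperSet_univ MeasurableSet.univ
  rw [Finset.card_singleton, pow_one, Set.inter_univ, probReal_univ, mul_one] at h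
  refine h.trans (le_of_eq ?_)
  congr 1; ext ω
  simp only [Set.mem_setOf_eq, Finset.coe_singleton, Set.singleton_subset_iff]

/-- **Box step**: a connection inside a sub-box `B ⊆ R` has `R`-free-law probability at least its `B`-free-law
probability (region monotonicity). [cite: Grimmett2006, Thm. (3.21) eq. (3.22), Lemma (4.13)] -/
theorem fkLaw_restrW_real_openConnIn_mono_region {q : ℝ} (hq : 1 ≤ q) (p : unitInterval)
    {B R : Finset (Site d)} (hBR : B ⊆ R) (u v : Site d) :
    (fkLaw B (restrW (↑B : Set (Site d)) (lattW d p)) q).real (openConnIn (↑B : Set (Site d)) u v) ≤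
      (fkLaw R (restrW (↑R : Set (Site d)) (lattW d p)) q).real (openConnIn (↑B : Set (Site d)) u v) :=
  fkLaw_restrW_real_mono_region hq (lattW d p) hBR (isUpperSet_openConnIn _ _ _)
    (measurableSet_openConnIn_of_countable _ _ _)

/-! ### (P1) v5 — LANE REGIONS: `R = (U ∩ Z) \ (S \ {z, w})`; the ambient pinned law dominates `p` on its pairs

The lane region of lane `k` is everything of the look box `U = v + ℓQ_g` inside the slab `Z_k` that is not frozen,
plus at most two frozen vertices: the exit `z` of the relay's plate and (optionally) the layer-1 vertex `w` on top
of the gate column used by the lane. Distinct slabs give disjoint regions; and since `z, w` are not lattice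
neighbours, NO pinned pair has both ends in `R`, so the pinned weighting is `≥ p` on the pairs of `R` — the
hypothesis `hW` of the sequential-trials lemma under `φ_ξ`. -/

/-- The frozen vertices of a lane region are among `{z, w}`. [folklore] -/
theorem mem_pair_of_mem_sdiff_sdiff {U S : Finset (Site d)} {z w x : Site d}
    (hx : x ∈ U \ (S \ {z, w})) (hxS : x ∈ S) : x = z ∨ x = w := by
  rw [Finset.mem_sdiff, Finset.mem_sdiff, not_and, not_not] at hx
  simpa [Finset.mem_insert, Finset.mem_singleton] using hx.2 hxS

/-- **`hW` for a lane region.** If `W` is the lattice weighting at `p` on the pairs inside `D ⊇ R` (subbox) and the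
only vertices of `R` inside the frozen set `S` are `z, w`, which are equal or NOT lattice neighbours, then the pinned
weighting `pinW W (wireSet S) ξ` is `≥ lattW p` on every pair of `R`, for EVERY pattern `ξ` (pairs off `S` keep
`W = p`; the only candidate pinned pair `zw` has lattice weight `0`). [cite: Grimmett2006, Thm. (3.7) (pinning = conditioning on the pattern); KozmaNitzan2024, §4 p. 17 (subbox)] -/
theorem lattW_le_pinW_of_frozen_pair {W : Sym2 (Site d) → unitInterval} {p : unitInterval} {D R : Finset (Site d)}
    (hsub : IsSubbox W p D) (hRD : R ⊆ D) {S : Set (Site d)} {z w : Site d}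
    (hRS : ∀ x ∈ R, x ∈ S → x = z ∨ x = w) (hzw : z = w ∨ ¬ (zdGraph d).Adj z w) (ξ : Set (Sym2 (Site d))) :
    ∀ e ∈ wireSet (↑R : Set (Site d)), lattW d p e ≤ pinW W (wireSet S) ξ e := by
  intro e he
  by_cases heS : e ∈ wireSet S
  · -- both ends frozen: then `e = s(z, w)` with `z ≠ w`, not a lattice edge
    induction e using Sym2.ind with
    | h a b =>
      obtain ⟨ha, hb, hab⟩ := mk_mem_wireSet_iff.1 he
      obtain ⟨haS, hbS, -⟩ := mk_mem_wireSet_iff.1 heS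
      have ha' := hRS a (Finset.mem_coe.1 ha) haS
      have hb' := hRS b (Finset.mem_coe.1 hb) hbS
      have hnadj : ¬ (zdGraph d).Adj a b := by
        intro hadj
        rcases hzw with hzw | hzw
        · subst hzw
          rcases ha' with rfl | rfl <;> rcases hb' with rfl | rfl <;> exact hab rfl
        · rcases ha' with rfl | rfl <;> rcases hb' with rfl | rfl
          · exact hab rfl
          · exact hzw hadj
          · exact hzw hadj.symm
          · exact hab rfl
      rw [lattW_mk, if_neg hnadj]
      exact bot_le
  · rw [pinW_apply_of_not_mem W ξ heS, hsub.eq_lattW (wireSet_mono (Finset.coe_subset.2 hRD) he)]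


/-! ### (P1) v5 — the slab-box corollary and lattice adjacency of coordinate neighbours -/

/-- Two sites agreeing off one coordinate and differing by `1` there are lattice neighbours. [folklore] -/
theorem zdGraph_adj_of_eq_off {x y : Site d} (i : Fin d) (h : ∀ j, j ≠ i → x j = y j)
    (hi : y i = x i + 1 ∨ x i = y i + 1) : (zdGraph d).Adj x y := by
  rw [zdGraph_adj_iff]
  refine ⟨i, ?_⟩
  rcases hi with hi | hi
  · left; funext j
    by_cases hj : j = i
    · subst hj; simp [hi]
    · simp [Pi.single_eq_of_ne hj, h j hj]
  · right; funext j
    by_cases hj : j = i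
    · subst hj; simp [hi]
    · simp [Pi.single_eq_of_ne hj, h j hj]

/-- **Slab-box routing.** A box whose width is `≥ 2L` everywhere and `≥ 2N` in every direction except possibly
the slab direction `c`, two points `s, t` with `|s_c - t_c| ≤ m·L` (a drift inside the slab) and
`|s_b - t_b| ≤ m·N` for `b ≠ c`; if there are two distinct directions `e₁, e₂ ≠ c` (`d ≥ 3`) then
`φ^free_box(s ↔ t in the box) ≥ β^{d·m}`.
[cite: Grimmett2006, §5.7 eq. (5.102), Thm. (3.8), eq. (3.22); KozmaNitzan2024, §4 Lemma 10 Step IV (pp. 19–21)] -/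
theorem pow_le_fkLaw_Icc_real_openConnIn_slabBox {q : ℝ} (hq : 1 ≤ q) (p : unitInterval) (hd : 2 ≤ d) {L : ℕ}
    {β : ℝ} (hβ0 : 0 ≤ β) (hβ1 : β ≤ 1)
    (hβ : ∀ (N : ℕ) (g : zdGraph d ≃g zdGraph d) (u z : Site d), u ∈ fkSlab d L N → z ∈ fkSlab d L N →
      β ≤ (fkLaw ((fkSlab d L N).image g) (restrW (↑((fkSlab d L N).image g) : Set (Site d)) (lattW d p)) q).real
        (openConnIn (↑((fkSlab d L N).image g) : Set (Site d)) (g u) (g z)))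
    (lo hi : Site d) (c e₁ e₂ : Fin d) (he : e₁ ≠ e₂) (he₁ : e₁ ≠ c) (he₂ : e₂ ≠ c)
    (hwide : ∀ b, lo b + 2 * (L : ℤ) ≤ hi b) (N : ℕ) (hfat : ∀ b, b ≠ c → lo b + 2 * (N : ℤ) ≤ hi b)
    (m : ℕ) {s t : Site d} (hs : s ∈ Finset.Icc lo hi) (ht : t ∈ Finset.Icc lo hi) (hc : |s c - t c| ≤ (m : ℤ) * L)
    (hdist : ∀ b, b ≠ c → |s b - t b| ≤ (m : ℤ) * N) :
    β ^ (d * m) ≤ (fkLaw (Finset.Icc lo hi) (restrW (↑(Finset.Icc lo hi) : Set (Site d)) (lattW d p)) q).real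
      (openConnIn (↑(Finset.Icc lo hi) : Set (Site d)) s t) := by
  have key : ∀ b, s b ≠ t b →
      (fun b => if b = e₁ then e₂ else e₁) b ≠ b ∧ lo b + 2 * ((fun b => if b = c then L else N) b : ℤ) ≤ hi b ∧
        lo ((fun b => if b = e₁ then e₂ else e₁) b) + 2 * ((fun b => if b = c then L else N) b : ℤ) ≤
          hi ((fun b => if b = e₁ then e₂ else e₁) b) ∧
        |s b - t b| ≤ ((fun _ => m) b : ℤ) * ((fun b => if b = c then L else N) b : ℕ) := by
    intro b _
    by_cases hbc : b = c
    · subst hbc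
      have hb1 : b ≠ e₁ := fun h => he₁ h.symm
      simp only [if_neg hb1, if_true]
      exact ⟨he₁, hwide _, hwide _, hc⟩
    · by_cases hb1 : b = e₁
      · subst hb1
        simp only [if_true, if_neg hbc]
        exact ⟨he.symm, hfat _ hbc, hfat _ he₂, hdist _ hbc⟩
      · simp only [if_neg hb1, if_neg hbc]
        exact ⟨Ne.symm hb1, hfat _ hbc, hfat _ he₁, hdist _ hbc⟩
  have h := pow_le_fkLaw_Icc_real_openConnIn_of_steps hq p hd hβ0 hβ1 hβ lo hi hwide (fun b => if b = c then L else N)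
    (fun b => if b = e₁ then e₂ else e₁) (fun _ => m) hs ht key
  simpa [Finset.sum_const, Finset.card_univ, Fintype.card_fin] using h


/-- **Edge step inside a region**: for lattice neighbours `u, v ∈ R`, `p̃ ≤ φ^free_R(u ↔ v in R)`.
[cite: Grimmett2006, Thm. (3.1) eq. (3.4)] -/
theorem ratio_le_fkLaw_restrW_real_openConnIn_edge {q : ℝ} (hq : 1 ≤ q) (p : unitInterval) (R : Finset (Site d))
    {u v : Site d} (hu : u ∈ R) (hv : v ∈ R) (hadj : (zdGraph d).Adj u v) :
    (p : ℝ) / (p + q * (1 - p)) ≤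
      (fkLaw R (restrW (↑R : Set (Site d)) (lattW d p)) q).real (openConnIn (↑R : Set (Site d)) u v) := by
  haveI : IsProbabilityMeasure (fkLaw R (restrW (↑R : Set (Site d)) (lattW d p)) q) :=
    isProbabilityMeasure_fkLaw _ _ (one_pos.trans_le hq)
  exact (ratio_le_fkLaw_restrW_real_edge hq p R hu hv hadj).trans (measureReal_mono
    (setOf_mem_subset_openConnIn (Finset.mem_coe.2 hu) (Finset.mem_coe.2 hv) hadj.ne) (measure_ne_top _ _))

/-- **Box step inside a region**: a lower bound for `s ↔ t` inside a sub-box `B ⊆ R` under the free law of `B`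
is a lower bound for `s ↔ t` inside `R` under the free law of `R`. [cite: Grimmett2006, Thm. (3.21) eq. (3.22), Lemma (4.13)] -/
theorem le_fkLaw_restrW_real_openConnIn_of_subbox {q : ℝ} (hq : 1 ≤ q) (p : unitInterval)
    {B R : Finset (Site d)} (hBR : B ⊆ R) (s t : Site d) {b : ℝ}
    (hb : b ≤ (fkLaw B (restrW (↑B : Set (Site d)) (lattW d p)) q).real (openConnIn (↑B : Set (Site d)) s t)) :
    b ≤ (fkLaw R (restrW (↑R : Set (Site d)) (lattW d p)) q).real (openConnIn (↑R : Set (Site d)) s t) := by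
  haveI : IsProbabilityMeasure (fkLaw R (restrW (↑R : Set (Site d)) (lattW d p)) q) :=
    isProbabilityMeasure_fkLaw _ _ (one_pos.trans_le hq)
  exact (hb.trans (fkLaw_restrW_real_openConnIn_mono_region hq p hBR s t)).trans
    (measureReal_mono (openConnIn_mono (Finset.coe_subset.2 hBR) _ _) (measure_ne_top _ _))

end Summit.CriticalPhenomena.PercolationContinuityZ3.Theorems.FK

end
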